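import Summits.Ventures.PercRepro.S2MaxExtensionPairs

/-!
# PercRepro — S2: THE SPANNING `6`-SETS WITH A MAXIMAL CLOSURE, COUNTED (p7, gen 13; sub-claim S2; the cells `(14, 8 … 11)`)

Every spanning `6`-set `S` (`S ∈ spanAll M 5`) contains exactly one circuit `C_S` of `3 … 6` points, and `S ↦ (C_S, S ∖ C_S)` is
injective (`exists_pair_of_mem_spanAll`); restricted to the sets with a MAXIMAL closure `|cl S| = f` the second component lies in
`(Matroid.subsF (Matroid.groundF M) (6 − |C_S|)).filter (fun B' => Disjoint B' C_S ∧ M.eRk (C_S ∪ B') = 5 ∧ (M.closure (C_S ∪ B')).ncard = f)`. **`card_spanMax_le_sum`** — `#{S ∈ spanAll : |cl S| = f} ≤ Σ_{k=3}^{6} Σ_{C ∈ circF k} #extMax C (6 − k) f`;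
**`card_spanMax_mul_six_le`** — with `e` a bound on the maximal extensions of every rank-`4` flat with `≥ 5` points and `n = |E|`,
`6·#{S ∈ spanAll : |cl S| = f} ≤ s₃·((n − 3)² − (n − 3))·e + s₄·3(n − 4)e + s₅·6e + s₆·6`
(the `6`-circuits are their own spanning `6`-set). Axioms: standard.
-/

open scoped Matroid

namespace PercRepro

namespace S2

open Set Finset

variable {α : Type} {M : Matroid α}

open scoped Classical in
/-- **The spanning `6`-sets with a maximal closure, through their circuits**: `#{S ∈ spanAll : |cl S| = f} ≤
Σ_{k=3}^{6} Σ_{C ∈ circF k} #extMax C (6 − k) f` (`S ↦ (C_S, S ∖ C_S)` is injective, `exists_pair_of_mem_spanAll`). -/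
theorem card_spanMax_le_sum [M.Finite] (f : ℕ) (hcirc : ∀ C, M.IsCircuit C → 3 ≤ C.encard) :
    ((spanAll M 5).filter (fun S => (M.closure S).ncard = f)).card ≤
      ∑ k ∈ Finset.Icc 3 6, ∑ C ∈ Matroid.circF M k, ((Matroid.subsF (Matroid.groundF M) (6 - k)).filter (fun B' => Disjoint B' C ∧ M.eRk (C ∪ B') = 5 ∧ (M.closure (C ∪ B')).ncard = f)).card := by
  set PP : Finset (Σ _ : Set α, Set α) :=
    (Finset.Icc 3 6).biUnion (fun k => (Matroid.circF M k).sigma (fun C => (Matroid.subsF (Matroid.groundF M) (6 - k)).filter (fun B' => Disjoint B' C ∧ M.eRk (C ∪ B') = 5 ∧ (M.closure (C ∪ B')).ncard = f))) with hPP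
  have h1 : PP.card ≤ ∑ k ∈ Finset.Icc 3 6, ∑ C ∈ Matroid.circF M k, ((Matroid.subsF (Matroid.groundF M) (6 - k)).filter (fun B' => Disjoint B' C ∧ M.eRk (C ∪ B') = 5 ∧ (M.closure (C ∪ B')).ncard = f)).card := by
    refine Finset.card_biUnion_le.trans (Finset.sum_le_sum (fun k _ => ?_))
    rw [Finset.card_sigma]
  refine le_trans ?_ h1
  apply Finset.card_le_card_of_surjOn (fun p : (Σ _ : Set α, Set α) => p.1 ∪ p.2)
  intro S hS
  rw [Finset.mem_coe, Finset.mem_filter] at hS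
  obtain ⟨hSall, hScl⟩ := hS
  obtain ⟨hSE, hSc, hSr⟩ := mem_spanAll.1 hSall
  obtain ⟨p, hp, hpS⟩ := exists_pair_of_mem_spanAll 5 hcirc hSall
  unfold Matroid.pairsF at hp
  rw [Finset.mem_filter, Finset.mem_biUnion] at hp
  obtain ⟨⟨k, hk, hpk⟩, hdis, -⟩ := hp
  rw [Finset.mem_product] at hpk
  obtain ⟨hC, hB'⟩ := hpk
  refine ⟨⟨p.1, p.2⟩, ?_, hpS⟩
  rw [Finset.mem_coe, hPP, Finset.mem_biUnion]
  refine ⟨k, hk, ?_⟩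
  rw [Finset.mem_sigma]
  refine ⟨hC, ?_⟩
  rw [mem_extMax]
  rw [mem_subsF_iff, Matroid.coe_groundF] at hB'
  refine ⟨hB', hdis, ?_, ?_⟩
  · rw [hpS]; exact hSr
  · rw [hpS]; exact hScl

/-- The rank of a `k`-circuit is `k − 1`, as naturals. -/
theorem eRk_eq_of_isCircuit_ncard [M.Finite] {C : Set α} (hC : M.IsCircuit C) {k : ℕ} (hk : C.ncard = k + 1) :
    M.eRk C = (k : ℕ∞) := by
  have h := hC.eRk_add_one_eq
  rw [← (M.ground_finite.subset hC.subset_ground).cast_ncard_eq, hk] at h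
  obtain ⟨q, hq⟩ := ENat.ne_top_iff_exists.1 (eRk_ne_top_of_finite hC.subset_ground)
  rw [← hq] at h ⊢
  norm_cast at h ⊢
  omega

open scoped Classical in
/-- **THE MAXIMAL-CLOSURE SPANNING `6`-SETS, COUNTED**: with `e` a bound on the maximal extensions of every rank-`4` flat with
`≥ 5` points and `n = |E|`,
`6·#{S ∈ spanAll : |cl S| = f} ≤ s₃·((n − 3)² − (n − 3))·e + s₄·3(n − 4)e + s₅·6e + s₆·6`. -/
theorem card_spanMax_mul_six_le [M.Finite] (f e : ℕ) (hcirc : ∀ C, M.IsCircuit C → 3 ≤ C.encard)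
    (he : ∀ P ⊆ M.E, M.closure P = P → M.eRk P = 4 → 5 ≤ P.ncard → ({x ∈ M.E \ P | (M.closure (insert x P)).ncard = f}).ncard ≤ e) :
    ((spanAll M 5).filter (fun S => (M.closure S).ncard = f)).card * 6 ≤
      {C | M.IsCircuit C ∧ C.ncard = 3}.ncard * (((M.E.ncard - 3) * (M.E.ncard - 3) - (M.E.ncard - 3)) * e) +
      {C | M.IsCircuit C ∧ C.ncard = 4}.ncard * (3 * ((M.E.ncard - 4) * e)) +
      {C | M.IsCircuit C ∧ C.ncard = 5}.ncard * (6 * e) +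
      {C | M.IsCircuit C ∧ C.ncard = 6}.ncard * 6 := by
  have h0 := card_spanMax_le_sum (M := M) f hcirc
  have hI : Finset.Icc 3 6 = {3, 4, 5, 6} := by decide
  rw [hI, Finset.sum_insert (by decide), Finset.sum_insert (by decide), Finset.sum_insert (by decide),
    Finset.sum_singleton] at h0
  -- the four circuit sizes
  have h3 : ∑ C ∈ Matroid.circF M 3, ((Matroid.subsF (Matroid.groundF M) (6 - 3)).filter (fun B' => Disjoint B' C ∧ M.eRk (C ∪ B') = 5 ∧ (M.closure (C ∪ B')).ncard = f)).card * 6 ≤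
      {C | M.IsCircuit C ∧ C.ncard = 3}.ncard * (((M.E.ncard - 3) * (M.E.ncard - 3) - (M.E.ncard - 3)) * e) := by
    rw [← Matroid.card_circF, Finset.card_eq_sum_ones, Finset.sum_mul]
    refine Finset.sum_le_sum (fun C hC => ?_)
    rw [one_mul]
    obtain ⟨hC, hC3⟩ := Matroid.mem_circF.1 hC
    have hCE := hC.subset_ground
    have hr : M.eRk C = 2 := eRk_eq_of_isCircuit_ncard hC (by rw [hC3])
    have hEC : (M.E \ C).ncard = M.E.ncard - 3 := by
      rw [Set.ncard_sdiff hCE (M.ground_finite.subset hCE), hC3]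
    have := card_extMax_three_mul_le hCE hr hC3 f e he
    rw [hEC] at this
    exact this
  have h4 : ∑ C ∈ Matroid.circF M 4, ((Matroid.subsF (Matroid.groundF M) (6 - 4)).filter (fun B' => Disjoint B' C ∧ M.eRk (C ∪ B') = 5 ∧ (M.closure (C ∪ B')).ncard = f)).card * 6 ≤
      {C | M.IsCircuit C ∧ C.ncard = 4}.ncard * (3 * ((M.E.ncard - 4) * e)) := by
    rw [← Matroid.card_circF, Finset.card_eq_sum_ones, Finset.sum_mul]
    refine Finset.sum_le_sum (fun C hC => ?_)
    rw [one_mul]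
    obtain ⟨hC, hC4⟩ := Matroid.mem_circF.1 hC
    have hCE := hC.subset_ground
    have hr : M.eRk C = 3 := eRk_eq_of_isCircuit_ncard hC (by rw [hC4])
    have hEC : (M.E \ C).ncard = M.E.ncard - 4 := by
      rw [Set.ncard_sdiff hCE (M.ground_finite.subset hCE), hC4]
    have := card_extMax_two_mul_le hCE hr (by omega) f e he
    rw [hEC] at this
    calc ((Matroid.subsF (Matroid.groundF M) (6 - 4)).filter (fun B' => Disjoint B' C ∧ M.eRk (C ∪ B') = 5 ∧ (M.closure (C ∪ B')).ncard = f)).card * 6 = ((Matroid.subsF (Matroid.groundF M) 2).filter (fun B' => Disjoint B' C ∧ M.eRk (C ∪ B') = 5 ∧ (M.closure (C ∪ B')).ncard = f)).card * 2 * 3 := by ring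
      _ ≤ (M.E.ncard - 4) * e * 3 := Nat.mul_le_mul_right 3 this
      _ = 3 * ((M.E.ncard - 4) * e) := by ring
  have h5 : ∑ C ∈ Matroid.circF M 5, ((Matroid.subsF (Matroid.groundF M) (6 - 5)).filter (fun B' => Disjoint B' C ∧ M.eRk (C ∪ B') = 5 ∧ (M.closure (C ∪ B')).ncard = f)).card * 6 ≤
      {C | M.IsCircuit C ∧ C.ncard = 5}.ncard * (6 * e) := by
    rw [← Matroid.card_circF, Finset.card_eq_sum_ones, Finset.sum_mul]
    refine Finset.sum_le_sum (fun C hC => ?_)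
    rw [one_mul]
    obtain ⟨hC, hC5⟩ := Matroid.mem_circF.1 hC
    have hCE := hC.subset_ground
    have hr : M.eRk C = 4 := eRk_eq_of_isCircuit_ncard hC (by rw [hC5])
    have h1 := card_extMax_one_le hr f
    have h2 : ({x ∈ M.E \ M.closure C | (M.closure (insert x (M.closure C))).ncard = f}).ncard ≤ e := by
      refine he _ (M.closure_subset_ground _) (M.closure_closure _) (by rw [M.eRk_closure_eq, hr]) ?_
      have := Set.ncard_le_ncard (M.subset_closure C hCE) (M.ground_finite.subset (M.closure_subset_ground C))
      omega
    calc ((Matroid.subsF (Matroid.groundF M) (6 - 5)).filter (fun B' => Disjoint B' C ∧ M.eRk (C ∪ B') = 5 ∧ (M.closure (C ∪ B')).ncard = f)).card * 6 ≤ e * 6 := Nat.mul_le_mul_right 6 (h1.trans h2)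
      _ = 6 * e := by ring
  have h6 : ∑ C ∈ Matroid.circF M 6, ((Matroid.subsF (Matroid.groundF M) (6 - 6)).filter (fun B' => Disjoint B' C ∧ M.eRk (C ∪ B') = 5 ∧ (M.closure (C ∪ B')).ncard = f)).card * 6 ≤
      {C | M.IsCircuit C ∧ C.ncard = 6}.ncard * 6 := by
    rw [← Matroid.card_circF, Finset.card_eq_sum_ones, Finset.sum_mul]
    refine Finset.sum_le_sum (fun C _ => ?_)
    rw [one_mul]
    have h1 : ((Matroid.subsF (Matroid.groundF M) (6 - 6)).filter (fun B' => Disjoint B' C ∧ M.eRk (C ∪ B') = 5 ∧ (M.closure (C ∪ B')).ncard = f)).card ≤ 1 := by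
      calc ((Matroid.subsF (Matroid.groundF M) (6 - 6)).filter (fun B' => Disjoint B' C ∧ M.eRk (C ∪ B') = 5 ∧ (M.closure (C ∪ B')).ncard = f)).card ≤ (Matroid.subsF (Matroid.groundF M) (6 - 6)).card :=
            Finset.card_filter_le _ _
        _ ≤ (Matroid.groundF M).card.choose (6 - 6) := Matroid.card_subsF_le _ _
        _ = 1 := by simp
    calc ((Matroid.subsF (Matroid.groundF M) (6 - 6)).filter (fun B' => Disjoint B' C ∧ M.eRk (C ∪ B') = 5 ∧ (M.closure (C ∪ B')).ncard = f)).card * 6 ≤ 1 * 6 := Nat.mul_le_mul_right 6 h1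
      _ = 6 := by norm_num
  calc ((spanAll M 5).filter (fun S => (M.closure S).ncard = f)).card * 6
      ≤ (∑ C ∈ Matroid.circF M 3, ((Matroid.subsF (Matroid.groundF M) (6 - 3)).filter (fun B' => Disjoint B' C ∧ M.eRk (C ∪ B') = 5 ∧ (M.closure (C ∪ B')).ncard = f)).card + ∑ C ∈ Matroid.circF M 4, ((Matroid.subsF (Matroid.groundF M) (6 - 4)).filter (fun B' => Disjoint B' C ∧ M.eRk (C ∪ B') = 5 ∧ (M.closure (C ∪ B')).ncard = f)).card +
          ∑ C ∈ Matroid.circF M 5, ((Matroid.subsF (Matroid.groundF M) (6 - 5)).filter (fun B' => Disjoint B' C ∧ M.eRk (C ∪ B') = 5 ∧ (M.closure (C ∪ B')).ncard = f)).card + ∑ C ∈ Matroid.circF M 6, ((Matroid.subsF (Matroid.groundF M) (6 - 6)).filter (fun B' => Disjoint B' C ∧ M.eRk (C ∪ B') = 5 ∧ (M.closure (C ∪ B')).ncard = f)).card) * 6 := by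
        rw [← add_assoc, ← add_assoc] at h0
        exact Nat.mul_le_mul_right 6 h0
    _ = ∑ C ∈ Matroid.circF M 3, ((Matroid.subsF (Matroid.groundF M) (6 - 3)).filter (fun B' => Disjoint B' C ∧ M.eRk (C ∪ B') = 5 ∧ (M.closure (C ∪ B')).ncard = f)).card * 6 + ∑ C ∈ Matroid.circF M 4, ((Matroid.subsF (Matroid.groundF M) (6 - 4)).filter (fun B' => Disjoint B' C ∧ M.eRk (C ∪ B') = 5 ∧ (M.closure (C ∪ B')).ncard = f)).card * 6 +
          ∑ C ∈ Matroid.circF M 5, ((Matroid.subsF (Matroid.groundF M) (6 - 5)).filter (fun B' => Disjoint B' C ∧ M.eRk (C ∪ B') = 5 ∧ (M.closure (C ∪ B')).ncard = f)).card * 6 + ∑ C ∈ Matroid.circF M 6, ((Matroid.subsF (Matroid.groundF M) (6 - 6)).filter (fun B' => Disjoint B' C ∧ M.eRk (C ∪ B') = 5 ∧ (M.closure (C ∪ B')).ncard = f)).card * 6 := by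
        rw [← Finset.sum_mul, ← Finset.sum_mul, ← Finset.sum_mul, ← Finset.sum_mul]
        ring
    _ ≤ _ := add_le_add (add_le_add (add_le_add h3 h4) h5) h6

end S2

end PercRepro
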